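import Summits.Langlands.Langlands.Theses.ParityBlindBianchi
import Literature.NumberTheory.Automorphic.CompletedCohomologyPoints

/-!
# `ArtinWeightRealisationLevel` (R′, stmt-Langlands-15111): the junk sector `0 ∈ S₀` splits off

Negative-side lemmas (crux disprover `cdisprove-stmt-Langlands-15111`, 2026-08-16; supports
stmt-Langlands-15111).

The crux binds its bad set as `S₀ : Finset ℕ` with the single side condition `p ∈ S₀`, and calls a
finite place `v` of `K` *good* iff `∀ ℓ ∈ S₀, ((ℓ : ℕ) : 𝓞 K) ∉ v.asIdeal`.  Since `((0 : ℕ) : 𝓞 K) = 0`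
lies in every prime, `0 ∈ S₀` leaves NO good place (`isEmpty_good_of_zero_mem`).  In that sector

* the generating Hecke family `{v // good} × Fin 2 → GL₂(𝔸_K^∞)` is indexed by an EMPTY type, and a
  Hecke point for an empty family ALWAYS exists (`isHeckePoint_of_isEmpty`: the constant class in
  `H⁰(X_{K(0)}, 𝒪/p^{t+1})` has exact annihilator `(p^{t+1})`, so `EigensystemOccurs` holds in
  degree `0` and the tree's `EigensystemOccurs.isHeckePoint` applies); with `U = GL₂(𝒪̂_K)` and any
  uniformisers the whole hypothesis package of R′ is therefore PROVABLE (`hyp_of_zero_mem`);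
* the conclusion degenerates to `∃ hcpt π, True`, i.e. to the bare existence of a cuspidal
  automorphic representation of `GL₂(𝔸_K)`.

Hence R′ splits as the conjunction of the intended statement (R′ with `0 ∉ S₀` added) and the
foreign existence statement "every imaginary quadratic `K` carrying a field isomorphism
`ℚ̄_p ≃+* ℂ` and an irreducible finite-image `σ : Γ_K → GL₂(ℚ̄_p)` has a cuspidal automorphic
representation of `GL₂(𝔸_K)`": `cuspForms_of_artinWeightRealisationLevel` (R′ proves the foreign
conjunct) and `instance_of_zero_mem_of_cuspForms` (in the zero sector R′ says nothing more); the
`iff` itself is recorded in the crux work file `Cruxes/ArtinWeightRealisationLevel/Disproof.lean`.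
Any proof of R′ as typed must therefore construct a Bianchi cusp form from `(K, ι, σ)` alone (the
line lead's stub `CuspFormsGL2Exist` is forced, not an artefact of the line `Sketch`); the
planner's repair is to add `0 ∉ S₀` (or `∀ ℓ ∈ S₀, ℓ.Prime`) to the `S₀`-binders of E2′/R′ (and
of E1′/D′, cf. `Theorems/IcosahedralDescentLevel/Negative/AllParityOfDoorOfDescent.lean`).  This
is a typing finding, not a refutation: the zero-sector conjunct is true.
-/

noncomputable section

set_option linter.dupNamespace false -- `Summit.Langlands.Langlands` is the mandated namespace (D-0017)

open CategoryTheory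
open scoped NumberField

namespace Summit.Langlands.Langlands.Theorems.ArtinWeightRealisationLevel.Negative

open Literature.NumberTheory.Automorphic Literature.NumberTheory.GaloisRepresentations
  IsDedekindDomain

universe u v

/-! ## Hecke points of an empty family of Hecke elements (any tower, any coefficients) -/

section EmptyFamily

variable {k : Type u} [CommRing k] {Γ 𝒢 : Type u} [Group Γ] [Group 𝒢]
variable (ι : Γ →* 𝒢) (L : Subgroup 𝒢) (M : Type u) [AddCommGroup M] [Module k M]

/-- The constant function with value `m` is a `Γ`-invariant of `Fun(𝒢 ⧸ L, M)`. [folklore] -/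
theorem const_mem_invariants (m : M) :
    (fun _ : 𝒢 ⧸ L => m) ∈ (ArithmeticQuotient.coeffRep k ι L M).ρ.invariants := by
  intro γ
  ext c
  simp [ArithmeticQuotient.coeffRep]

/-- A scalar kills the degree-`0` class `[m] ∈ H⁰(X_L, M)` of the constant function `m` (through
Mathlib's `groupCohomology.H0Iso`) iff it kills `m`. [folklore] -/
theorem smul_constClass_eq_zero_iff (a : k) (m : M) :
    a • (groupCohomology.H0Iso (ArithmeticQuotient.coeffRep k ι L M)).inv
        ⟨fun _ => m, const_mem_invariants (k := k) ι L M m⟩ = 0 ↔ a • m = 0 := by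
  constructor
  · intro h
    have h1 := congrArg
      (fun x => (groupCohomology.H0Iso (ArithmeticQuotient.coeffRep k ι L M)).hom x) h
    simp only [map_smul, map_zero] at h1
    have h2 := congrArg
      (fun f : (ArithmeticQuotient.coeffRep k ι L M).ρ.invariants =>
        (f : (𝒢 ⧸ L) → M) ((1 : 𝒢) : 𝒢 ⧸ L)) h1
    simpa using h2
  · intro h
    have h1 : a • (⟨fun _ => m, const_mem_invariants (k := k) ι L M m⟩ :
        (ArithmeticQuotient.coeffRep k ι L M).ρ.invariants) = 0 := by
      ext c
      simp [h]
    rw [← map_smul, h1, map_zero]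

/-- The degree-`0` class of a non-zero constant function is non-zero. [folklore] -/
theorem constClass_ne_zero {m : M} (hm : m ≠ 0) :
    (groupCohomology.H0Iso (ArithmeticQuotient.coeffRep k ι L M)).inv
      ⟨fun _ => m, const_mem_invariants (k := k) ι L M m⟩ ≠ 0 := by
  intro h
  have := (smul_constClass_eq_zero_iff (k := k) ι L M 1 m).1 (by rw [one_smul]; exact h)
  exact hm (by simpa using this)

variable {ι L M}
variable (T : LevelTower 𝒢) (ϖ : k) {J : Type v} (δ : J → 𝒢) (χ : J → k)

/-- **For an EMPTY family of Hecke elements every "system of eigenvalues" occurs** (in degree `0`,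
witnessed by the constant class `[1] ∈ H⁰(X_{K(0)}, k/ϖ^{t+1})`, whose annihilator is exactly
`(ϖ^{t+1})`), provided `ϖ` is not a unit. [folklore] -/
theorem eigensystemOccurs_of_isEmpty [IsEmpty J] (hϖ : ¬ IsUnit ϖ) :
    EigensystemOccurs ι T ϖ δ χ 0 := by
  intro t
  refine ⟨0, (groupCohomology.H0Iso
      (ArithmeticQuotient.coeffRep k ι (T.level 0) (modPow k ϖ (t + 1)))).inv
        ⟨fun _ => 1, const_mem_invariants (k := k) ι (T.level 0) (modPow k ϖ (t + 1)) 1⟩,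
    ⟨?_, fun j => isEmptyElim j⟩, ?_⟩
  · apply constClass_ne_zero
    intro h10
    apply hϖ
    have : Ideal.span {ϖ ^ (t + 1)} = ⊤ := by
      rw [Ideal.eq_top_iff_one]
      exact (Ideal.Quotient.eq_zero_iff_mem).1 h10
    rw [Ideal.span_singleton_eq_top] at this
    exact (isUnit_pow_iff (Nat.succ_ne_zero t)).1 this
  · intro a ha
    rw [smul_constClass_eq_zero_iff, Algebra.smul_def, mul_one] at ha
    exact (Ideal.Quotient.eq_zero_iff_mem).1 ha

/-- **An empty family of Hecke elements has a Hecke point** (`Spf 𝕋(Kᵖ)` is then the formal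
spectrum of the closure of the scalars, and `H⁰ ≠ 0` makes the scalars act faithfully modulo every
`ϖ^t`): `IsHeckePoint` holds for every `χ`, provided `ϖ` is not a unit. [folklore] -/
theorem isHeckePoint_of_isEmpty [IsEmpty J] (hϖ : ¬ IsUnit ϖ) : IsHeckePoint ι T ϖ δ χ :=
  (eigensystemOccurs_of_isEmpty (ι := ι) T ϖ δ χ hϖ).isHeckePoint

end EmptyFamily

/-! ## The zero sector of R′ -/

/-- With `0 ∈ S₀` no finite place of `K` is good. [folklore] -/
theorem isEmpty_good_of_zero_mem {S₀ : Finset ℕ} (h0 : (0 : ℕ) ∈ S₀)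
    (K : Type) [Field K] [NumberField K] :
    IsEmpty {v : HeightOneSpectrum (𝓞 K) // ∀ ℓ ∈ S₀, ((ℓ : ℕ) : 𝓞 K) ∉ v.asIdeal} :=
  ⟨fun v => v.2 0 h0 (by simp)⟩

/-- `p` is not a unit of `𝒪_{ℚ̄_p}` (its valuation is `1/p < 1`). [folklore] -/
theorem not_isUnit_natCast_valuationSubring (p : ℕ) [Fact p.Prime] :
    ¬ IsUnit ((p : ℕ) : (Valued.v (R := PadicAlgCl p)).valuationSubring) := by
  rintro ⟨u, hu⟩
  have h1 : ((u : (Valued.v (R := PadicAlgCl p)).valuationSubring) : PadicAlgCl p) *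
      (((u⁻¹ : ((Valued.v (R := PadicAlgCl p)).valuationSubring)ˣ) :
        (Valued.v (R := PadicAlgCl p)).valuationSubring) : PadicAlgCl p) = 1 := by
    rw [← Subring.coe_mul, Units.mul_inv]
    rfl
  have hv := congrArg (Valued.v : PadicAlgCl p → NNReal) h1
  rw [map_mul, map_one, hu] at hv
  have hle : Valued.v ((((u⁻¹ : ((Valued.v (R := PadicAlgCl p)).valuationSubring)ˣ) :
      (Valued.v (R := PadicAlgCl p)).valuationSubring) : PadicAlgCl p)) ≤ 1 :=
    ((u⁻¹ : ((Valued.v (R := PadicAlgCl p)).valuationSubring)ˣ) :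
      (Valued.v (R := PadicAlgCl p)).valuationSubring).2
  have hp : Valued.v ((((p : ℕ) : (Valued.v (R := PadicAlgCl p)).valuationSubring) : PadicAlgCl p)) =
      1 / (p : NNReal) := by
    rw [show ((((p : ℕ) : (Valued.v (R := PadicAlgCl p)).valuationSubring) : PadicAlgCl p)) =
      (p : PadicAlgCl p) from rfl]
    exact PadicAlgCl.valuation_p p
  rw [hp] at hv
  have hp1 : (1 : NNReal) < p := by exact_mod_cast (Fact.out : p.Prime).one_lt
  have : (1 : NNReal) / p * Valued.v ((((u⁻¹ : ((Valued.v (R := PadicAlgCl p)).valuationSubring)ˣ) :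
      (Valued.v (R := PadicAlgCl p)).valuationSubring) : PadicAlgCl p)) < 1 := by
    calc (1 : NNReal) / p * _ ≤ 1 / p * 1 := by gcongr
      _ < 1 := by
        rw [mul_one, one_div]
        exact inv_lt_one_of_one_lt₀ hp1
  exact absurd hv this.ne

/-- Every finite place has a unit uniformiser in its completion (`valuation_exists_uniformizer`,
`HeightOneSpectrum.valuedAdicCompletion_eq_valuation'`). [folklore] -/
theorem exists_units_uniformizer {K : Type} [Field K] [NumberField K]
    (v : HeightOneSpectrum (𝓞 K)) :
    ∃ ϖ : (v.adicCompletion K)ˣ, Valued.v ((ϖ : (v.adicCompletion K)ˣ) : v.adicCompletion K) =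
      WithZero.exp (-1 : ℤ) := by
  obtain ⟨π, hπ⟩ := v.valuation_exists_uniformizer K
  have hne : ((π : K) : v.adicCompletion K) ≠ 0 := by
    intro h
    have := HeightOneSpectrum.valuedAdicCompletion_eq_valuation' v π
    rw [h, map_zero, hπ] at this
    exact WithZero.coe_ne_zero this.symm
  exact ⟨Units.mk0 _ hne, by rw [Units.val_mk0, HeightOneSpectrum.valuedAdicCompletion_eq_valuation', hπ]⟩

/-- **In the zero sector the hypothesis package of R′ is provable** for every `K`, `p`, `σ`:
`U = GL₂(𝒪̂_K)`, any uniformisers, any eigenvalue family (its domain is empty), the Hecke point of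
the empty family, and a vacuous association clause. [folklore] -/
theorem hyp_of_zero_mem (K : Type) [Field K] [NumberField K] (p : ℕ) [Fact p.Prime]
    (σ : FramedGaloisRep K (PadicAlgCl p) 2) (S₀ : Finset ℕ) (h0 : (0 : ℕ) ∈ S₀) :
    ∃ (U : Subgroup (GL (Fin 2) (IsDedekindDomain.FiniteAdeleRing (NumberField.RingOfIntegers K) K))) (ϖ : ∀ v : IsDedekindDomain.HeightOneSpectrum (NumberField.RingOfIntegers K), (v.adicCompletion K)ˣ) (a : {v : IsDedekindDomain.HeightOneSpectrum (NumberField.RingOfIntegers K) // ∀ ℓ ∈ S₀, ((ℓ : ℕ) : NumberField.RingOfIntegers K) ∉ v.asIdeal} → ℕ → (Valued.v (R := PadicAlgCl p)).valuationSubring), IsOpen (U : Set (GL (Fin 2) (IsDedekindDomain.FiniteAdeleRing (NumberField.RingOfIntegers K) K))) ∧ U ≤ Literature.NumberTheory.Automorphic.glFiniteIntegralLevel 2 K ∧ (∀ g ∈ Literature.NumberTheory.Automorphic.glFiniteIntegralLevel 2 K, (∀ v : IsDedekindDomain.HeightOneSpectrum (NumberField.RingOfIntegers K), ¬ (∀ ℓ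 ∈ S₀, ((ℓ : ℕ) : NumberField.RingOfIntegers K) ∉ v.asIdeal) → ∀ i j : Fin 2, ((g : Matrix (Fin 2) (Fin 2) (IsDedekindDomain.FiniteAdeleRing (NumberField.RingOfIntegers K) K)) i j) v = (1 : Matrix (Fin 2) (Fin 2) (v.adicCompletion K)) i j) → g ∈ U) ∧ (∀ v : IsDedekindDomain.HeightOneSpectrum (NumberField.RingOfIntegers K), Valued.v ((ϖ v : (v.adicCompletion K)ˣ) : v.adicCompletion K) = WithZero.exp (-1 : ℤ)) ∧ Literature.NumberTheory.Automorphic.IsHeckePoint (Matrix.GeneralLinearGroup.map (n := Fin 2) (algebraMap K (IsDedekindDomain.FiniteAdeleRing (NumberField.RingOfIntegers K) K))) (Literature.NumberTheory.Automorphic.LevelTower.ofSeq U (fun r : ℕ => (Literature.NumberTheory.Automorphic.principalCongruenceLevel 2 K (Ideal.span {((p : ℕ) : NumberField.RingOfIntegers K)} ^ r)).map (Literature.NumberTheory.Automorphic.GLn.sndHom 2 K))) ((p : ℕ) : (Valued.v (R := PadicAlgCl p)).valuationSubring) (fun j : {v : IsDedekindDomain.HeightOneSpectrum (NumberField.RingOfIntegers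 K) // ∀ ℓ ∈ S₀, ((ℓ : ℕ) : NumberField.RingOfIntegers K) ∉ v.asIdeal} × Fin 2 => Literature.NumberTheory.Automorphic.GLn.sndHom 2 K (Literature.NumberTheory.Automorphic.heckeDiagAt 2 K j.1.1 (ϖ j.1.1) (j.2.val + 1))) (fun j => a j.1 (j.2.val + 1)) ∧ ∀ (v : IsDedekindDomain.HeightOneSpectrum (NumberField.RingOfIntegers K)) (hv : ∀ ℓ ∈ S₀, ((ℓ : ℕ) : NumberField.RingOfIntegers K) ∉ v.asIdeal), σ.IsHeckeAssociatedAt v (fun i : ℕ => if i = 0 then (1 : PadicAlgCl p) else ((a ⟨v, hv⟩ i : (Valued.v (R := PadicAlgCl p)).valuationSubring) : PadicAlgCl p)) := by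
  haveI := isEmpty_good_of_zero_mem h0 K
  refine ⟨glFiniteIntegralLevel 2 K, fun v => Classical.choose (exists_units_uniformizer v),
    fun v => isEmptyElim v, isOpen_glFiniteIntegralLevel 2 K, le_rfl, fun g hg _ => hg,
    fun v => Classical.choose_spec (exists_units_uniformizer v), ?_, fun v hv => ?_⟩
  · exact isHeckePoint_of_isEmpty _ _ _ _ (not_isUnit_natCast_valuationSubring p)
  · exact isEmptyElim (⟨v, hv⟩ : {v : HeightOneSpectrum (𝓞 K) // ∀ ℓ ∈ S₀, ((ℓ : ℕ) : 𝓞 K) ∉ v.asIdeal})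

open Summit.Langlands.Langlands.Theses.ParityBlindBianchi

/-- **R′ proves the zero-sector conjunct** — the bare existence of a cuspidal automorphic
representation of `GL₂(𝔸_K)` for every imaginary quadratic `K` carrying a field isomorphism
`ι : ℚ̄_p ≃+* ℂ` and an irreducible finite-image `σ : Γ_K → GL₂(ℚ̄_p)`: feed R′ the bad set
`{0, p}` and the provable hypothesis package of the zero sector (`hyp_of_zero_mem`); no place is
good, so its conclusion is `∃ hcpt π, True`.  Any proof of R′ as typed must therefore produce a
Bianchi cusp form out of `(K, ι, σ)` alone. [folklore] -/
theorem cuspForms_of_artinWeightRealisationLevel (h : ArtinWeightRealisationLevel)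
    (K : Type) [Field K] [NumberField K] (htc : NumberField.IsTotallyComplex K)
    (hdeg : Module.finrank ℚ K = 2) (p : ℕ) [Fact p.Prime] (ι : PadicAlgCl p ≃+* ℂ)
    (σ : FramedGaloisRep K (PadicAlgCl p) 2) (hfin : Finite σ.toMonoidHom.range)
    (hirr : σ.toGaloisRep.IsIrreducible) :
    ∃ hcpt : isCompact_glFiniteIntegralLevel 2 K, Nonempty (CuspidalAutomorphicRepData 2 K hcpt) := by
  obtain ⟨hcpt, π, -⟩ := h K htc hdeg p ι σ hfin hirr {0, p} (by simp)
    (hyp_of_zero_mem K p σ {0, p} (by simp))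
  exact ⟨hcpt, ⟨π⟩⟩

/-- **In the zero sector R′ says nothing about `σ`**: for `0 ∈ S₀` the instance of R′ at
`(K, p, ι, σ, S₀)` — hypothesis package included — follows from the mere existence of a cuspidal
automorphic representation of `GL₂(𝔸_K)` (the compatibility clause quantifies over no place).
[folklore] -/
theorem instance_of_zero_mem_of_cuspForms (K : Type) [Field K] [NumberField K] (p : ℕ)
    [Fact p.Prime] (ι : PadicAlgCl p ≃+* ℂ) (σ : FramedGaloisRep K (PadicAlgCl p) 2)
    (S₀ : Finset ℕ) (h0 : (0 : ℕ) ∈ S₀)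
    (hC : ∃ hcpt : isCompact_glFiniteIntegralLevel 2 K, Nonempty (CuspidalAutomorphicRepData 2 K hcpt)) :
    ∃ (hcpt : isCompact_glFiniteIntegralLevel 2 K) (π : CuspidalAutomorphicRepData 2 K hcpt),
      ∀ w : HeightOneSpectrum (𝓞 K), (∀ ℓ ∈ S₀, ((ℓ : ℕ) : 𝓞 K) ∉ w.asIdeal) →
        SatakeFrobCompatibleAt ι π.1 σ w := by
  obtain ⟨hcpt, ⟨π⟩⟩ := hC
  haveI := isEmpty_good_of_zero_mem h0 K
  exact ⟨hcpt, π, fun w hw =>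
    isEmptyElim (⟨w, hw⟩ : {v : HeightOneSpectrum (𝓞 K) // ∀ ℓ ∈ S₀, ((ℓ : ℕ) : 𝓞 K) ∉ v.asIdeal})⟩

end Summit.Langlands.Langlands.Theorems.ArtinWeightRealisationLevel.Negative

end
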